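import Summits.QuantumFields.YangMills.Theorems.FemtoCurvatureTwoPoint.Negative.UnfaithfulFalse
import Literature.MathematicalPhysics.QuantumLattice.GaugeGroupsProofs

/-!
# `FemtoCurvatureTwoPoint` — faithfulness of `r` is load-bearing, UNCONDITIONALLY
# (witness `SU(2)` with the trivial representation)

Negative lemma for crux `Summit.QuantumFields.YangMills.Theses.LangevinControlUV.
FemtoCurvatureTwoPoint` (item stmt-QuantumFields-9363; cdisprove gen 2).

`Negative.UnfaithfulFalse.femtoCurvatureTwoPoint_unfaithful_false_of_su` (gen 1) refuted the
unfaithful variant of the crux (the datum `r : LatticeRep G` weakened to a bare continuous unitary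
`ρ : G →* U(N)`, everything else verbatim) MODULO the then-unproved named fact
`isSimpleCompactGroup_specialUnitaryGroup`. That fact is now a theorem of the tree
(`Literature.MathematicalPhysics.QuantumLattice.isSimpleCompactGroup_specialUnitaryGroup_holds`,
file `GaugeGroupsProofs`), so the refutation is unconditional:

* `isCompactSimpleLieGroup_su` — `SU(n)`, `n ≥ 2`, IS a compact simple Lie group in the sense of
  the crux's hypothesis `IsCompactSimpleLieGroup` (so the crux is NOT vacuously true: its `∀ G`
  ranges over a non-empty class, and any refutation needs exactly one faithful `r` of one `SU(n)`
  violating the package — the template `not_femtoCurvatureTwoPoint_of_su`);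
* `femtoCurvatureTwoPoint_unfaithful_false'` — the unfaithful variant is FALSE (witness `SU(2)`,
  `ρ = 1`: the plaquette field vanishes identically while the lower bound `c Γ > 0` is demanded on
  the femto torus `L = 8`).
-/

noncomputable section

open Filter Topology MeasureTheory
open Literature.MathematicalPhysics.QuantumFieldTheory Literature.MathematicalPhysics.QuantumLattice
open Summit.QuantumFields.YangMills.Theorems.FemtoCurvatureTwoPoint.Negative.UnfaithfulFalse
  (femtoCurvatureTwoPoint_unfaithful_false_of_su)

namespace Summit.QuantumFields.YangMills.Theorems.FemtoCurvatureTwoPoint.Negative.UnfaithfulFalseSU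

/-- `SU(n)`, `n ≥ 2`, satisfies the crux's group hypothesis `IsCompactSimpleLieGroup`
(unconditionally: simplicity from `GaugeGroupsProofs`, the fundamental representation is faithful
unitary continuous). -/
theorem isCompactSimpleLieGroup_su {n : ℕ} (hn : 2 ≤ n) :
    IsCompactSimpleLieGroup (Matrix.specialUnitaryGroup (Fin n) ℂ) :=
  isCompactSimpleLieGroup_specialUnitaryGroup isSimpleCompactGroup_specialUnitaryGroup_holds hn

/-- **Refutation template, unconditional form.** ONE faithful unitary continuous representation
`r` of ONE `SU(n)`, `n ≥ 2`, at which the crux body fails refutes `FemtoCurvatureTwoPoint`. -/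
theorem not_femtoCurvatureTwoPoint_of_su {n : ℕ} (hn : 2 ≤ n)
    (r : LatticeRep (Matrix.specialUnitaryGroup (Fin n) ℂ))
    (h : letI : MeasurableSpace (Matrix.specialUnitaryGroup (Fin n) ℂ) := borel _
      haveI : BorelSpace (Matrix.specialUnitaryGroup (Fin n) ℂ) := ⟨rfl⟩
      ¬ ∃ (a : ℝ → ℝ), ∃ (Γ : ℝ → ℝ) (β₀ ℓ₀ c C : ℝ), 0 < ℓ₀ ∧ 0 < c ∧ (∀ β, 0 < a β) ∧
        Filter.Tendsto a Filter.atTop (nhds 0) ∧ (∀ s : ℝ, 0 < s → s ≤ ℓ₀ → 0 < Γ s ∧ Γ s ≤ 1) ∧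
        ∀ (L : ℕ) [NeZero L] (β : ℝ), β₀ ≤ β → (L : ℝ) * a β ≤ ℓ₀ →
          let P : (Fin 4 → ZMod L) → Fin 4 → Fin 4 →
              GaugeConfig 4 L (Matrix.specialUnitaryGroup (Fin n) ℂ) → ℝ :=
            fun x i j U => (r.N : ℝ) - (r.ρ (plaquetteHolonomy U x i j)).trace.re
          let E : (GaugeConfig 4 L (Matrix.specialUnitaryGroup (Fin n) ℂ) → ℝ) → ℝ :=
            fun F => wilsonExpectation (d := 4) (L := L) r.ρ β F
          let cov : (GaugeConfig 4 L (Matrix.specialUnitaryGroup (Fin n) ℂ) → ℝ) →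
              (GaugeConfig 4 L (Matrix.specialUnitaryGroup (Fin n) ℂ) → ℝ) → ℝ :=
            fun F F' => E (fun U => F U * F' U) - E F * E F'
          let dist : (Fin 4 → ZMod L) → (Fin 4 → ZMod L) → ℝ :=
            fun x y => Real.sqrt (∑ k : Fin 4, (((x k - y k).valMinAbs : ℤ) : ℝ) ^ 2)
          (∀ n : ℕ, 1 ≤ n → 8 * n ≤ L →
              c * Γ ((n : ℝ) * a β) ≤
                  (n : ℝ) ^ 8 * cov (P 0 0 1) (P (Pi.single (2 : Fin 4) ((n : ℕ) : ZMod L)) 0 1) ∧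
                (n : ℝ) ^ 8 * cov (P 0 0 1) (P (Pi.single (2 : Fin 4) ((n : ℕ) : ZMod L)) 0 1) ≤
                  C * Γ ((n : ℝ) * a β)) ∧
            (∀ (x y : Fin 4 → ZMod L) (i j i' j' : Fin 4), x ≠ y → i ≠ j → i' ≠ j' →
              |cov (P x i j) (P y i' j')| * dist x y ^ 8 ≤ C * Γ (dist x y * a β))) :
    ¬ Summit.QuantumFields.YangMills.Theses.LangevinControlUV.FemtoCurvatureTwoPoint :=
  fun hc => h (hc (Matrix.specialUnitaryGroup (Fin n) ℂ) (isCompactSimpleLieGroup_su hn) r)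

/-- **The unfaithful variant of the crux is FALSE, unconditionally**: `FemtoCurvatureTwoPoint`
with `r : LatticeRep G` replaced by a bare continuous unitary `ρ : G →* U(N)` (everything else
verbatim) fails at `G = SU(2)`, `ρ = 1`. -/
theorem femtoCurvatureTwoPoint_unfaithful_false' :
    ¬ (∀ (G : Type) [Group G] [TopologicalSpace G] [IsTopologicalGroup G] [CompactSpace G],
        IsCompactSimpleLieGroup G →
          letI : MeasurableSpace G := borel G
          haveI : BorelSpace G := ⟨rfl⟩
          ∀ (N : ℕ) (ρ : G →* Matrix (Fin N) (Fin N) ℂ), Continuous ρ →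
            (∀ g, ρ g ∈ Matrix.unitaryGroup (Fin N) ℂ) →
            ∃ (a : ℝ → ℝ), ∃ (Γ : ℝ → ℝ) (β₀ ℓ₀ c C : ℝ), 0 < ℓ₀ ∧ 0 < c ∧ (∀ β, 0 < a β) ∧
              Filter.Tendsto a Filter.atTop (nhds 0) ∧
              (∀ s : ℝ, 0 < s → s ≤ ℓ₀ → 0 < Γ s ∧ Γ s ≤ 1) ∧
              ∀ (L : ℕ) [NeZero L] (β : ℝ), β₀ ≤ β → (L : ℝ) * a β ≤ ℓ₀ →
                let P : (Fin 4 → ZMod L) → Fin 4 → Fin 4 → GaugeConfig 4 L G → ℝ :=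
                  fun x i j U => (N : ℝ) - (ρ (plaquetteHolonomy U x i j)).trace.re
                let E : (GaugeConfig 4 L G → ℝ) → ℝ := fun F =>
                  wilsonExpectation (d := 4) (L := L) ρ β F
                let cov : (GaugeConfig 4 L G → ℝ) → (GaugeConfig 4 L G → ℝ) → ℝ := fun F F' =>
                  E (fun U => F U * F' U) - E F * E F'
                let dist : (Fin 4 → ZMod L) → (Fin 4 → ZMod L) → ℝ := fun x y =>
                  Real.sqrt (∑ k : Fin 4, (((x k - y k).valMinAbs : ℤ) : ℝ) ^ 2)
                (∀ n : ℕ, 1 ≤ n → 8 * n ≤ L →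
                    c * Γ ((n : ℝ) * a β) ≤
                        (n : ℝ) ^ 8 * cov (P 0 0 1) (P (Pi.single (2 : Fin 4) ((n : ℕ) : ZMod L)) 0 1) ∧
                      (n : ℝ) ^ 8 * cov (P 0 0 1) (P (Pi.single (2 : Fin 4) ((n : ℕ) : ZMod L)) 0 1) ≤
                        C * Γ ((n : ℝ) * a β)) ∧
                  (∀ (x y : Fin 4 → ZMod L) (i j i' j' : Fin 4), x ≠ y → i ≠ j → i' ≠ j' →
                    |cov (P x i j) (P y i' j')| * dist x y ^ 8 ≤ C * Γ (dist x y * a β))) :=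
  femtoCurvatureTwoPoint_unfaithful_false_of_su isSimpleCompactGroup_specialUnitaryGroup_holds

end Summit.QuantumFields.YangMills.Theorems.FemtoCurvatureTwoPoint.Negative.UnfaithfulFalseSU

end
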